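import Mathlib
import HarnessLib
import Literature.Analysis.FluidPDE.TaoAveragedNondegeneracy
import Summits.NavierStokesRegularity.NavierStokesRegularity.Theorems.UnthreadedDoorNetFluxDefs
import Summits.NavierStokesRegularity.NavierStokesRegularity.Theorems.UnthreadedDoorNetFluxEnvelopeDefs
import Summits.NavierStokesRegularity.NavierStokesRegularity.Theorems.UnthreadedDoorNetFluxEnvelopeToolkit
import Summits.NavierStokesRegularity.NavierStokesRegularity.Theorems.UnthreadedDoorNetFluxEnvelopeRegularity
import Summits.NavierStokesRegularity.NavierStokesRegularity.Theorems.UnthreadedDoorNetFluxEnvelopeDefect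
import Summits.NavierStokesRegularity.NavierStokesRegularity.Theorems.UnthreadedDoorNetFluxExtremalHeadCore

/-!
# Route `UnthreadedDoor`, crux `PoloidalLiouville` (stmt-NavierStokesRegularity-1222), WALL W1 — netflux line,
# NF-1a: THE EXTREMAL HEAD DIFFERENCE ON ONE TIME SLICE — the a.e. slope bound (part (v) of `ExtremalHeadEMF`)

Part of the proof of the research stub NF-1a `stub_extremalHeadEMF` (`NetFlux.ExtremalHeadEMF`).  Slice data as in
`UnthreadedDoorNetFluxExtremalHeadCore`: `v` smooth with `‖v‖ ≤ V`, `T` smooth and `P ∈ C¹` off `x₀`, `∇P − m∇T ∥ (x − x₀)`,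
`m = ⟪v, x − x₀⟫`, every sphere saddle-free.

* (uses the tree's `radDeriv_eq_fderiv`, p664045: `radDeriv P x₀ x` is `DP(x)` applied to the unit radial vector);
* `ae_differentiableAt_sphSup_sphInf` — `r ↦ max_{S_r} T`, `min_{S_r} T` are differentiable at a.e. `r > 0` (Lipschitz on
  compact radius intervals, Rademacher / Lebesgue);
* **`hasDerivAt_head_diff`** — DANSKIN STEP: at a radius `r > 0` where both spherical extrema are differentiable, for ANY
  selections `x⁺(ρ) ∈ argmax`, `x⁻(ρ) ∈ argmin` and ANY extremisers `z⁺, z⁻` at `r`, the extremal head difference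
  `ρ ↦ P(x⁺(ρ)) − P(x⁻(ρ))` is differentiable at `r` with derivative `∂_r P(z⁺) − ∂_r P(z⁻)`: moving `z^±` radially to `S_ρ`
  costs `P(x^±(ρ)) − P(x₀ + ρ ξ^±)`, which by (Λ) is `≤ Vρ · (max_{S_ρ} T − T(x₀ + ρξ⁺))`, and the bracket is `≥ 0`, vanishes
  at `ρ = r` and is differentiable there, hence `o(ρ − r)` (Fermat);
* **`ae_deriv_head_diff_le`** — (v): for a.e. `r > 0`,
  `deriv (P∘x⁺ − P∘x⁻)(r) ≤ sup_{argmax} ∂_r P − inf_{argmin} ∂_r P`.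

WHAT THIS IS NOT: no NS statement; `PoloidalLiouville` (1222), W1, the line's rung and NF-1a itself stay OPEN here.
`--supports stmt-NavierStokesRegularity-1222 --as helper`.  [folklore]
-/

noncomputable section

-- the summit and its single sub-problem share the name (CONVENTIONS §1)
set_option linter.dupNamespace false

open Set Function Filter Topology InnerProductSpace MeasureTheory Metric Asymptotics
open scoped RealInnerProductSpace ContDiff

namespace Summit.NavierStokesRegularity.NavierStokesRegularity.Theorems.PoloidalLiouville.NetFlux

open Literature.Analysis Literature.Analysis.FluidPDE

/-! ### The radial derivative and a.e. differentiability of the spherical extrema -/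

/-- `|radDeriv P x₀ x| ≤ ‖DP(x)‖` for `x ≠ x₀`. [folklore] -/
theorem abs_radDeriv_le {P : E3 → ℝ} {x₀ x : E3} (hP : DifferentiableAt ℝ P x) (hx : x ≠ x₀) :
    |radDeriv P x₀ x| ≤ ‖fderiv ℝ P x‖ := by
  have hr : 0 < ‖x - x₀‖ := norm_pos_iff.2 (sub_ne_zero.2 hx)
  rw [radDeriv_eq_fderiv hx hP, ← Real.norm_eq_abs]
  calc ‖fderiv ℝ P x (‖x - x₀‖⁻¹ • (x - x₀))‖ ≤ ‖fderiv ℝ P x‖ * ‖‖x - x₀‖⁻¹ • (x - x₀)‖ :=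
        ContinuousLinearMap.le_opNorm _ _
    _ = ‖fderiv ℝ P x‖ := by
        rw [norm_smul, norm_inv, norm_norm, inv_mul_cancel₀ hr.ne', mul_one]

/-- **The spherical extrema are differentiable at a.e. radius** (`T ∈ C¹(ℝ³ ∖ {x₀})`): Lipschitz on every `[1/(n+1), n+1]`
(`exists_lipschitz_sphSup_sphInf`), hence differentiable a.e. there (Lebesgue / Rademacher). [folklore] -/
theorem ae_differentiableAt_sphSup_sphInf {T : E3 → ℝ} {x₀ : E3} (hT : ContDiffOn ℝ 1 T ({x₀}ᶜ : Set E3)) :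
    ∀ᵐ r : ℝ, 0 < r → DifferentiableAt ℝ (fun ρ => sphSup T x₀ ρ) r ∧ DifferentiableAt ℝ (fun ρ => sphInf T x₀ ρ) r := by
  have hn : ∀ n : ℕ, ∀ᵐ r : ℝ, r ∈ Ioo (1 / ((n : ℝ) + 1)) ((n : ℝ) + 1) →
      DifferentiableAt ℝ (fun ρ => sphSup T x₀ ρ) r ∧ DifferentiableAt ℝ (fun ρ => sphInf T x₀ ρ) r := by
    intro n
    have ha : (0 : ℝ) < 1 / ((n : ℝ) + 1) := by positivity
    obtain ⟨K, hK0, hK⟩ := exists_lipschitz_sphSup_sphInf hT ha (b := (n : ℝ) + 1)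
    set s : Set ℝ := Icc (1 / ((n : ℝ) + 1)) ((n : ℝ) + 1) with hs
    have hLs : LipschitzOnWith K.toNNReal (fun ρ => sphSup T x₀ ρ) s :=
      LipschitzOnWith.of_dist_le_mul fun r hr r' hr' => by
        rw [Real.dist_eq, Real.dist_eq]
        exact (hK r hr r' hr').1.trans (mul_le_mul_of_nonneg_right (Real.le_coe_toNNReal K) (abs_nonneg _))
    have hLi : LipschitzOnWith K.toNNReal (fun ρ => sphInf T x₀ ρ) s :=
      LipschitzOnWith.of_dist_le_mul fun r hr r' hr' => by
        rw [Real.dist_eq, Real.dist_eq]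
        exact (hK r hr r' hr').2.trans (mul_le_mul_of_nonneg_right (Real.le_coe_toNNReal K) (abs_nonneg _))
    filter_upwards [hLs.ae_differentiableWithinAt_of_mem (μ := volume),
      hLi.ae_differentiableWithinAt_of_mem (μ := volume)] with r h1 h2 hr
    have hrs : r ∈ s := Ioo_subset_Icc_self hr
    have hnhds : s ∈ 𝓝 r := mem_of_superset (Ioo_mem_nhds hr.1 hr.2) Ioo_subset_Icc_self
    exact ⟨(h1 hrs).differentiableAt hnhds, (h2 hrs).differentiableAt hnhds⟩
  rw [← ae_all_iff] at hn
  filter_upwards [hn] with r hr hr0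
  -- choose `n` with `1/(n+1) < r < n+1`
  obtain ⟨n₁, hn₁⟩ := exists_nat_one_div_lt hr0
  obtain ⟨n₂, hn₂⟩ := exists_nat_gt r
  set n := max n₁ n₂ with hndef
  refine hr n ⟨lt_of_le_of_lt ?_ hn₁, lt_of_lt_of_le hn₂ ?_⟩
  · exact one_div_le_one_div_of_le (by positivity) (by simp [hndef])
  · have : (n₂ : ℝ) ≤ n := by exact_mod_cast le_max_right n₁ n₂
    linarith

/-! ### Danskin step: the derivative of the extremal head difference -/

section Slice

variable {v : E3 → E3} {T P : E3 → ℝ} {x₀ : E3} {V : ℝ}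

/-- **Danskin step** (see the module docstring). [folklore] -/
theorem hasDerivAt_head_diff (hv : ContDiff ℝ (⊤ : ℕ∞) v) (hT : ContDiffOn ℝ (⊤ : ℕ∞) T ({x₀}ᶜ : Set E3))
    (hP : ContDiffOn ℝ 1 P ({x₀}ᶜ : Set E3)) (hV : ∀ x, ‖v x‖ ≤ V)
    (hpar : ∀ x, x ≠ x₀ → cross (gradient P x - (⟪v x, x - x₀⟫) • gradient T x) (x - x₀) = 0)
    (hU : ∀ r > 0, IsUnimodalSphere T x₀ r)
    {xp xm : ℝ → E3} (hxp : ∀ r > 0, xp r ∈ sphArgmax T x₀ r) (hxm : ∀ r > 0, xm r ∈ sphArgmin T x₀ r)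
    {r : ℝ} (hr : 0 < r) (hdp : DifferentiableAt ℝ (fun ρ => sphSup T x₀ ρ) r)
    (hdm : DifferentiableAt ℝ (fun ρ => sphInf T x₀ ρ) r)
    {zp zm : E3} (hzp : zp ∈ sphArgmax T x₀ r) (hzm : zm ∈ sphArgmin T x₀ r) :
    HasDerivAt (fun ρ => P (xp ρ) - P (xm ρ)) (radDeriv P x₀ zp - radDeriv P x₀ zm) r := by
  have hV0 : 0 ≤ V := (norm_nonneg _).trans (hV x₀)
  have hTc : ∀ {ρ : ℝ}, 0 < ρ → ContinuousOn T (Metric.sphere x₀ ρ) := fun hρ =>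
    continuousOn_sphere_of_continuousOn_compl hT.continuousOn hρ
  -- unit directions of the extremisers at `r`
  have hunit : ∀ {x : E3}, x ∈ Metric.sphere x₀ r → ‖r⁻¹ • (x - x₀)‖ = 1 ∧ x = x₀ + r • (r⁻¹ • (x - x₀)) := by
    intro x hx
    refine ⟨?_, ?_⟩
    · rw [norm_smul, norm_inv, Real.norm_eq_abs, abs_of_pos hr, mem_sphere_iff_norm.1 hx, inv_mul_cancel₀ hr.ne']
    · rw [smul_smul, mul_inv_cancel₀ hr.ne', one_smul, add_sub_cancel]
  have hmemS : ∀ {ρ : ℝ}, 0 < ρ → ∀ ξ : E3, ‖ξ‖ = 1 → x₀ + ρ • ξ ∈ Metric.sphere x₀ ρ := by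
    intro ρ hρ ξ hξ
    rw [mem_sphere_iff_norm, add_sub_cancel_left, norm_smul, hξ, mul_one, Real.norm_eq_abs, abs_of_pos hρ]
  have hne : ∀ {ρ : ℝ}, 0 < ρ → ∀ ξ : E3, ‖ξ‖ = 1 → x₀ + ρ • ξ ≠ x₀ := fun hρ ξ hξ =>
    ne_center_of_mem_sphere hρ (hmemS hρ ξ hξ)
  obtain ⟨hξp, hzpe⟩ := hunit hzp.1
  obtain ⟨hξm, hzme⟩ := hunit hzm.1
  set ξp := r⁻¹ • (zp - x₀) with hξpdef
  set ξm := r⁻¹ • (zm - x₀) with hξmdef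
  -- the radial derivatives
  have hPd : ∀ {x : E3}, x ≠ x₀ → DifferentiableAt ℝ P x := fun hx =>
    (hP.differentiableOn one_ne_zero _ hx).differentiableAt (isOpen_compl_singleton.mem_nhds hx)
  have hT1 : ContDiffOn ℝ 1 T ({x₀}ᶜ : Set E3) := hT.of_le (by exact_mod_cast le_top)
  have hTd : ∀ {x : E3}, x ≠ x₀ → DifferentiableAt ℝ T x := fun hx =>
    (hT1.differentiableOn one_ne_zero _ hx).differentiableAt (isOpen_compl_singleton.mem_nhds hx)
  have hMp : HasDerivAt (fun ρ : ℝ => P (x₀ + ρ • ξp)) (radDeriv P x₀ zp) r := by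
    have hd := hasDerivAt_radial (x₀ := x₀) (ξ := ξp) (ρ := r) (hPd (hne hr ξp hξp))
    rw [← hzpe] at hd
    have e : radDeriv P x₀ zp = fderiv ℝ P zp ξp := by
      rw [radDeriv_eq_fderiv (ne_center_of_mem_sphere hr hzp.1) (hPd (ne_center_of_mem_sphere hr hzp.1)),
        mem_sphere_iff_norm.1 hzp.1]
    rw [e]; exact hd
  have hMm : HasDerivAt (fun ρ : ℝ => P (x₀ + ρ • ξm)) (radDeriv P x₀ zm) r := by
    have hd := hasDerivAt_radial (x₀ := x₀) (ξ := ξm) (ρ := r) (hPd (hne hr ξm hξm))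
    rw [← hzme] at hd
    have e : radDeriv P x₀ zm = fderiv ℝ P zm ξm := by
      rw [radDeriv_eq_fderiv (ne_center_of_mem_sphere hr hzm.1) (hPd (ne_center_of_mem_sphere hr hzm.1)),
        mem_sphere_iff_norm.1 hzm.1]
    rw [e]; exact hd
  -- the defect functions `φ(ρ) = max_{S_ρ} T − T(x₀ + ρ ξ⁺)`, `ψ(ρ) = T(x₀ + ρ ξ⁻) − min_{S_ρ} T`
  have hφd : DifferentiableAt ℝ (fun ρ : ℝ => sphSup T x₀ ρ - T (x₀ + ρ • ξp)) r :=
    hdp.sub (hasDerivAt_radial (hTd (hne hr ξp hξp))).differentiableAt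
  have hψd : DifferentiableAt ℝ (fun ρ : ℝ => T (x₀ + ρ • ξm) - sphInf T x₀ ρ) r :=
    (hasDerivAt_radial (hTd (hne hr ξm hξm))).differentiableAt.sub hdm
  have hφ0 : sphSup T x₀ r - T (x₀ + r • ξp) = 0 := by
    rw [← hzpe, sphSup_eq_of_mem_sphArgmax (hTc hr) hzp, sub_self]
  have hinfz : sphInf T x₀ r = T zm := by
    refine IsLeast.csInf_eq ⟨⟨zm, hzm.1, rfl⟩, ?_⟩
    rintro _ ⟨y, hy, rfl⟩; exact hzm.2 y hy
  have hψ0 : T (x₀ + r • ξm) - sphInf T x₀ r = 0 := by rw [← hzme, hinfz, sub_self]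
  have hφnn : ∀ ρ : ℝ, 0 < ρ → 0 ≤ sphSup T x₀ ρ - T (x₀ + ρ • ξp) := fun ρ hρ =>
    sub_nonneg.2 (le_sphSup (hTc hρ) (hmemS hρ ξp hξp))
  have hψnn : ∀ ρ : ℝ, 0 < ρ → 0 ≤ T (x₀ + ρ • ξm) - sphInf T x₀ ρ := fun ρ hρ =>
    sub_nonneg.2 (csInf_le ((isCompact_sphere x₀ ρ).bddBelow_image (hTc hρ)) ⟨_, hmemS hρ ξm hξm, rfl⟩)
  -- Fermat: derivative zero at the minimum `ρ = r`, hence `o(ρ - r)`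
  have hlittle : ∀ {φ : ℝ → ℝ}, DifferentiableAt ℝ φ r → φ r = 0 → (∀ ρ : ℝ, 0 < ρ → 0 ≤ φ ρ) →
      φ =o[𝓝 r] fun ρ => ρ - r := by
    intro φ hφ h0 hnn
    have hmin : IsLocalMin φ r := by
      filter_upwards [Ioi_mem_nhds hr] with ρ hρ
      rw [h0]; exact hnn ρ hρ
    have hderiv : HasDerivAt φ 0 r := by
      have h := hφ.hasDerivAt
      rwa [hmin.hasDerivAt_eq_zero h] at h
    rw [hasDerivAt_iff_isLittleO] at hderiv
    simpa [h0] using hderiv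
  have hφo := hlittle hφd hφ0 hφnn
  have hψo := hlittle hψd hψ0 hψnn
  -- the end corrections are `o(ρ - r)`
  have hEp : (fun ρ => P (xp ρ) - P (x₀ + ρ • ξp)) =o[𝓝 r] fun ρ => ρ - r := by
    refine IsBigO.trans_isLittleO ?_ hφo
    refine IsBigO.of_bound (V * (r + 1)) ?_
    filter_upwards [Ioi_mem_nhds hr, Iio_mem_nhds (lt_add_one r)] with ρ hρ hρ1
    have h1 := abs_head_sub_le hv hT hP hV hpar hU hρ (hxp ρ hρ).1 (hmemS hρ ξp hξp)
    rw [Real.norm_eq_abs, Real.norm_eq_abs, sphSup_eq_of_mem_sphArgmax (hTc hρ) (hxp ρ hρ)]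
    exact h1.trans (mul_le_mul_of_nonneg_right (mul_le_mul_of_nonneg_left hρ1.le hV0) (abs_nonneg _))
  have hEm : (fun ρ => P (xm ρ) - P (x₀ + ρ • ξm)) =o[𝓝 r] fun ρ => ρ - r := by
    refine IsBigO.trans_isLittleO ?_ hψo
    refine IsBigO.of_bound (V * (r + 1)) ?_
    filter_upwards [Ioi_mem_nhds hr, Iio_mem_nhds (lt_add_one r)] with ρ hρ hρ1
    have h1 := abs_head_sub_le hv hT hP hV hpar hU hρ (hxm ρ hρ).1 (hmemS hρ ξm hξm)
    have hinf : sphInf T x₀ ρ = T (xm ρ) := by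
      refine IsLeast.csInf_eq ⟨⟨xm ρ, (hxm ρ hρ).1, rfl⟩, ?_⟩
      rintro _ ⟨y, hy, rfl⟩; exact (hxm ρ hρ).2 y hy
    rw [Real.norm_eq_abs, Real.norm_eq_abs, hinf, abs_sub_comm (T (x₀ + ρ • ξm))]
    exact h1.trans (mul_le_mul_of_nonneg_right (mul_le_mul_of_nonneg_left hρ1.le hV0) (abs_nonneg _))
  -- assemble: `J ρ - J r - (ρ - r) D = [M ρ - M r - (ρ - r) D] + E⁺ ρ - E⁻ ρ`
  have hM : HasDerivAt (fun ρ : ℝ => P (x₀ + ρ • ξp) - P (x₀ + ρ • ξm)) (radDeriv P x₀ zp - radDeriv P x₀ zm) r :=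
    hMp.sub hMm
  rw [hasDerivAt_iff_isLittleO] at hM ⊢
  have hJr : P (xp r) - P (xm r) = P (x₀ + r • ξp) - P (x₀ + r • ξm) := by
    rw [← hzpe, ← hzme]
    exact head_diff_indep hv hT hP hV hpar hU hr (hxp r hr) hzp (hxm r hr) hzm
  have hsum := (hM.add hEp).sub hEm
  refine hsum.congr' (Eventually.of_forall fun ρ => ?_) (Eventually.of_forall fun _ => rfl)
  simp only [hJr, smul_eq_mul]
  ring

/-- **(v) The a.e. slope bound**: for ANY selections of extremisers, for a.e. `r > 0`,
`deriv (P∘x⁺ − P∘x⁻)(r) ≤ sup_{argmax_{S_r} T} ∂_r P − inf_{argmin_{S_r} T} ∂_r P`. [folklore] -/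
theorem ae_deriv_head_diff_le (hv : ContDiff ℝ (⊤ : ℕ∞) v) (hT : ContDiffOn ℝ (⊤ : ℕ∞) T ({x₀}ᶜ : Set E3))
    (hP : ContDiffOn ℝ 1 P ({x₀}ᶜ : Set E3)) (hV : ∀ x, ‖v x‖ ≤ V)
    (hpar : ∀ x, x ≠ x₀ → cross (gradient P x - (⟪v x, x - x₀⟫) • gradient T x) (x - x₀) = 0)
    (hU : ∀ r > 0, IsUnimodalSphere T x₀ r)
    {xp xm : ℝ → E3} (hxp : ∀ r > 0, xp r ∈ sphArgmax T x₀ r) (hxm : ∀ r > 0, xm r ∈ sphArgmin T x₀ r) :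
    ∀ᵐ r : ℝ, 0 < r → deriv (fun ρ => P (xp ρ) - P (xm ρ)) r ≤
      sSup (radDeriv P x₀ '' sphArgmax T x₀ r) - sInf (radDeriv P x₀ '' sphArgmin T x₀ r) := by
  have hT1 : ContDiffOn ℝ 1 T ({x₀}ᶜ : Set E3) := hT.of_le (by exact_mod_cast le_top)
  filter_upwards [ae_differentiableAt_sphSup_sphInf hT1] with r hr hr0
  obtain ⟨hdp, hdm⟩ := hr hr0
  have hD := hasDerivAt_head_diff hv hT hP hV hpar hU hxp hxm hr0 hdp hdm (hxp r hr0) (hxm r hr0)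
  rw [hD.deriv]
  -- `radDeriv P` is bounded on the sphere
  obtain ⟨K, -, hK⟩ := exists_bound_fderiv_shell hP hr0 (b := r)
  have hbd : ∀ x ∈ Metric.sphere x₀ r, |radDeriv P x₀ x| ≤ K := by
    intro x hx
    have hx0 := ne_center_of_mem_sphere hr0 hx
    have hPd : DifferentiableAt ℝ P x :=
      (hP.differentiableOn one_ne_zero _ hx0).differentiableAt (isOpen_compl_singleton.mem_nhds hx0)
    exact (abs_radDeriv_le hPd hx0).trans (hK x (by rw [mem_sphere_iff_norm.1 hx]; exact ⟨le_rfl, le_rfl⟩))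
  have hup : BddAbove (radDeriv P x₀ '' sphArgmax T x₀ r) :=
    ⟨K, by rintro _ ⟨x, hx, rfl⟩; exact (abs_le.1 (hbd x hx.1)).2⟩
  have hlow : BddBelow (radDeriv P x₀ '' sphArgmin T x₀ r) :=
    ⟨-K, by rintro _ ⟨x, hx, rfl⟩; exact (abs_le.1 (hbd x hx.1)).1⟩
  exact sub_le_sub (le_csSup hup (mem_image_of_mem _ (hxp r hr0))) (csInf_le hlow (mem_image_of_mem _ (hxm r hr0)))

end Slice

end Summit.NavierStokesRegularity.NavierStokesRegularity.Theorems.PoloidalLiouville.NetFlux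

end
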